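import Mathlib

/-!
# `DegreeOnePrimesEscape`: the finite-group core (coset counting, sharp) and the combinatorial
# skeleton of the crux inequality

Support / tightness lemmas for crux `stmt-QuantumAdvantage-11543` (route LinnikCubicClassGroups),
extracted from the refuter work file
`Summits/QuantumAdvantage/QuantumAdvantage/Cruxes/DegreeOnePrimesEscape/Disproof.lean` so that
provers, planners and ideators can IMPORT them. Everything here is elementary and sorry-free; the
analytic inputs (Thorner–Zaman 2019 Thm 1.4 for the Hilbert class field, Stark 1974) are NOT used.

* `card_le_two_mul_ncard_compl`: a proper subgroup misses at least half of a finite group.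
* `card_le_four_mul_ncard_compl_union`: `K₁` of index `2`, `M` proper ⇒ at least a quarter of the
  group lies outside `M ∪ K₁`; `four_mul_ncard_compl_union_eq`: this is SHARP (equality for `M` of
  index `2`, `M ≠ K₁`) — the `h/4` of the paper proof's exceptional-character case cannot improve.
* `ncard_escapeSet_eq_sum`: the crux's counted set, fibred over the ideal classes outside `M`.
* `crux_ineq_of_classwise_half` / `crux_ineq_of_classwise_quarter`: classwise lower bounds on the
  number of degree-one primes (outside `M`, resp. outside `M ∪ K₁`) plus `π(x) ≤ 4ah`
  (resp. `≤ 2ah`) give the crux inequality `π(x) ≤ 8 · #escapeSet` verbatim.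
-/

open scoped NumberField nonZeroDivisors

namespace Summit.QuantumAdvantage.QuantumAdvantage.Theorems.DegreeOnePrimesEscape.Negative

/-! ## Coset counting -/

/-- A proper subgroup misses at least half of a finite group. [folklore] -/
theorem card_le_two_mul_ncard_compl {G : Type*} [Group G] [Finite G] (M : Subgroup G)
    (hM : M ≠ ⊤) : Nat.card G ≤ 2 * ((M : Set G)ᶜ).ncard := by
  have hMi : 2 ≤ M.index := Subgroup.one_lt_index_of_ne_top hM
  have hMc : Nat.card M * M.index = Nat.card G := M.card_mul_index
  have hM2 : 2 * Nat.card M ≤ Nat.card G := by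
    calc 2 * Nat.card M ≤ M.index * Nat.card M := Nat.mul_le_mul_right _ hMi
      _ = Nat.card G := by rw [mul_comm]; exact hMc
  have hMset : (M : Set G).ncard = Nat.card M := by
    rw [← Nat.card_coe_set_eq, SetLike.coe_sort_coe]
  have hcompl : (M : Set G).ncard + ((M : Set G)ᶜ).ncard = Nat.card G :=
    Set.ncard_add_ncard_compl _
  omega

/-- **Coset counting behind the exceptional-character case.** If `K₁` has index `2` and `M` is a
proper subgroup of a finite group, at least a quarter of the group lies outside `M ∪ K₁`.
(Index two: the product of two non-members of `K₁` is a member, so `a ↦ m₀⁻¹a` injects `M \ K₁`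
into `M ∩ K₁` for any `m₀ ∈ M \ K₁`.) [folklore] -/
theorem card_le_four_mul_ncard_compl_union {G : Type*} [Group G] [Finite G] (M K₁ : Subgroup G)
    (hM : M ≠ ⊤) (hK : K₁.index = 2) :
    Nat.card G ≤ 4 * (((M : Set G) ∪ (K₁ : Set G))ᶜ).ncard := by
  classical
  have hMi : 2 ≤ M.index := Subgroup.one_lt_index_of_ne_top hM
  have hMc : Nat.card M * M.index = Nat.card G := M.card_mul_index
  have hKc : Nat.card K₁ * 2 = Nat.card G := by rw [← hK]; exact K₁.card_mul_index
  have hM2 : 2 * Nat.card M ≤ Nat.card G := by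
    calc 2 * Nat.card M ≤ M.index * Nat.card M := Nat.mul_le_mul_right _ hMi
      _ = Nat.card G := by rw [mul_comm]; exact hMc
  have hMset : (M : Set G).ncard = Nat.card M := by
    rw [← Nat.card_coe_set_eq, SetLike.coe_sort_coe]
  have hKset : (K₁ : Set G).ncard = Nat.card K₁ := by
    rw [← Nat.card_coe_set_eq, SetLike.coe_sort_coe]
  have hKcompl : (K₁ : Set G).ncard + ((K₁ : Set G)ᶜ).ncard = Nat.card G :=
    Set.ncard_add_ncard_compl _
  by_cases hle : M ≤ K₁
  · have hU : ((M : Set G) ∪ (K₁ : Set G)) = (K₁ : Set G) :=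
      Set.union_eq_self_of_subset_left (SetLike.coe_subset_coe.mpr hle)
    rw [hU]
    omega
  · obtain ⟨m₀, hm₀M, hm₀K⟩ : ∃ m, m ∈ (M : Set G) ∧ m ∉ (K₁ : Set G) :=
      Set.not_subset.mp (fun h => hle (SetLike.coe_subset_coe.mp h))
    have hm₀K' : m₀⁻¹ ∉ K₁ := fun h => hm₀K (by simpa using K₁.inv_mem h)
    set A : Set G := (M : Set G) \ (K₁ : Set G) with hA
    set B : Set G := (M : Set G) ∩ (K₁ : Set G) with hB
    set E : Set G := ((M : Set G) ∪ (K₁ : Set G))ᶜ with hE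
    have hAB : A.ncard ≤ B.ncard := by
      refine Set.ncard_le_ncard_of_injOn (fun a => m₀⁻¹ * a) ?_ ?_ (Set.toFinite B)
      · rintro a ⟨haM, haK⟩
        refine ⟨M.mul_mem (M.inv_mem hm₀M) haM, ?_⟩
        exact (Subgroup.mul_mem_iff_of_index_two hK).mpr (iff_of_false hm₀K' haK)
      · intro a _ b _ hab
        exact mul_left_cancel hab
    have hApB : B.ncard + A.ncard = (M : Set G).ncard :=
      Set.ncard_inter_add_ncard_sdiff_eq_ncard _ _
    have hKE : ((K₁ : Set G)ᶜ) = A ∪ E := by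
      ext g
      simp only [hA, hE, Set.mem_compl_iff, SetLike.mem_coe, Set.mem_union, Set.mem_sdiff, not_or]
      tauto
    have hdisj : Disjoint A E := by
      rw [Set.disjoint_left]
      rintro g ⟨hgM, -⟩ hgE
      exact hgE (Or.inl hgM)
    have hKE' : ((K₁ : Set G)ᶜ).ncard = A.ncard + E.ncard := by
      rw [hKE, Set.ncard_union_eq hdisj]
    omega

/-- **Sharpness of the quarter.** For `M` of index `2` different from `K₁` (index `2`) exactly a
quarter of the group lies outside `M ∪ K₁`; so the `h/4` classes of the exceptional-character case
of the paper proof cannot be improved by group theory alone. [folklore] -/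
theorem four_mul_ncard_compl_union_eq {G : Type*} [Group G] [Finite G] (M K₁ : Subgroup G)
    (hM : M.index = 2) (hK : K₁.index = 2) (hne : M ≠ K₁) :
    4 * (((M : Set G) ∪ (K₁ : Set G))ᶜ).ncard = Nat.card G := by
  classical
  have hMc : Nat.card M * 2 = Nat.card G := by rw [← hM]; exact M.card_mul_index
  have hKc : Nat.card K₁ * 2 = Nat.card G := by rw [← hK]; exact K₁.card_mul_index
  have hMset : (M : Set G).ncard = Nat.card M := by
    rw [← Nat.card_coe_set_eq, SetLike.coe_sort_coe]
  have hKset : (K₁ : Set G).ncard = Nat.card K₁ := by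
    rw [← Nat.card_coe_set_eq, SetLike.coe_sort_coe]
  have hKcompl : (K₁ : Set G).ncard + ((K₁ : Set G)ᶜ).ncard = Nat.card G :=
    Set.ncard_add_ncard_compl _
  have hle : ¬ M ≤ K₁ := by
    intro hle
    apply hne
    exact Subgroup.eq_of_le_of_card_ge hle (by
      have : Nat.card M = Nat.card K₁ := by omega
      exact this.ge)
  obtain ⟨m₀, hm₀M, hm₀K⟩ : ∃ m, m ∈ (M : Set G) ∧ m ∉ (K₁ : Set G) :=
    Set.not_subset.mp (fun h => hle (SetLike.coe_subset_coe.mp h))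
  have hm₀K' : m₀⁻¹ ∉ K₁ := fun h => hm₀K (by simpa using K₁.inv_mem h)
  set A : Set G := (M : Set G) \ (K₁ : Set G) with hA
  set B : Set G := (M : Set G) ∩ (K₁ : Set G) with hB
  set E : Set G := ((M : Set G) ∪ (K₁ : Set G))ᶜ with hE
  have hAB : A.ncard ≤ B.ncard := by
    refine Set.ncard_le_ncard_of_injOn (fun a => m₀⁻¹ * a) ?_ ?_ (Set.toFinite B)
    · rintro a ⟨haM, haK⟩
      refine ⟨M.mul_mem (M.inv_mem hm₀M) haM, ?_⟩
      exact (Subgroup.mul_mem_iff_of_index_two hK).mpr (iff_of_false hm₀K' haK)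
    · intro a _ b _ hab
      exact mul_left_cancel hab
  have hBA : B.ncard ≤ A.ncard := by
    refine Set.ncard_le_ncard_of_injOn (fun b => m₀ * b) ?_ ?_ (Set.toFinite A)
    · rintro b ⟨hbM, hbK⟩
      refine ⟨M.mul_mem hm₀M hbM, ?_⟩
      intro hprod
      exact hm₀K (((Subgroup.mul_mem_iff_of_index_two hK).mp hprod).mpr hbK)
    · intro a _ b _ hab
      exact mul_left_cancel hab
  have hApB : B.ncard + A.ncard = (M : Set G).ncard :=
    Set.ncard_inter_add_ncard_sdiff_eq_ncard _ _
  have hKE : ((K₁ : Set G)ᶜ) = A ∪ E := by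
    ext g
    simp only [hA, hE, Set.mem_compl_iff, SetLike.mem_coe, Set.mem_union, Set.mem_sdiff, not_or]
    tauto
  have hdisj : Disjoint A E := by
    rw [Set.disjoint_left]
    rintro g ⟨hgM, -⟩ hgE
    exact hgE (Or.inl hgM)
  have hKE' : ((K₁ : Set G)ᶜ).ncard = A.ncard + E.ncard := by
    rw [hKE, Set.ncard_union_eq hdisj]
  omega

open scoped Classical in
/-- Bridge: the complement of `M` as a filtered `Finset`. [folklore] -/
theorem ncard_compl_eq_card_filter {G : Type*} [Group G] [Fintype G] (M : Subgroup G) :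
    ((M : Set G)ᶜ).ncard = (Finset.univ.filter fun g : G => g ∉ M).card := by
  rw [← Set.ncard_coe_finset]
  congr 1
  ext g
  simp

open scoped Classical in
/-- Bridge: the complement of `M ∪ K₁` as a filtered `Finset`. [folklore] -/
theorem ncard_compl_union_eq_card_filter {G : Type*} [Group G] [Fintype G] (M K₁ : Subgroup G) :
    (((M : Set G) ∪ (K₁ : Set G))ᶜ).ncard =
      (Finset.univ.filter fun g : G => g ∉ M ∧ g ∉ K₁).card := by
  rw [← Set.ncard_coe_finset]
  congr 1
  ext g
  simp

open scoped Classical in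
/-- **Mass outside a proper subgroup** (cases without an exceptional character, or with the trivial
one): a classwise lower bound `a` on every class outside `M` gives total mass `≥ a·|G|/2` outside
`M`. [folklore] -/
theorem escape_mass_half {G : Type*} [Group G] [Fintype G] (M : Subgroup G) (hM : M ≠ ⊤)
    (f : G → ℕ) (a : ℕ) (hf : ∀ g : G, g ∉ M → a ≤ f g) :
    a * Fintype.card G ≤ 2 * ∑ g ∈ Finset.univ.filter (fun g : G => g ∉ M), f g := by
  have h1 := card_le_two_mul_ncard_compl M hM
  rw [Nat.card_eq_fintype_card, ncard_compl_eq_card_filter] at h1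
  have h2 : a * (Finset.univ.filter fun g : G => g ∉ M).card ≤
      ∑ g ∈ Finset.univ.filter (fun g : G => g ∉ M), f g := by
    calc a * (Finset.univ.filter fun g : G => g ∉ M).card
        = ∑ _g ∈ Finset.univ.filter (fun g : G => g ∉ M), a := by
          rw [Finset.sum_const, smul_eq_mul, mul_comm]
      _ ≤ _ := Finset.sum_le_sum fun g hg => hf g (by simpa using hg)
  calc a * Fintype.card G ≤ a * (2 * (Finset.univ.filter fun g : G => g ∉ M).card) :=
        Nat.mul_le_mul_left _ h1
    _ = 2 * (a * (Finset.univ.filter fun g : G => g ∉ M).card) := by ring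
    _ ≤ _ := Nat.mul_le_mul_left _ h2

open scoped Classical in
/-- **Mass outside a proper subgroup, exceptional-character case**: a classwise lower bound `a` only
on the classes outside `M ∪ K₁` (`K₁` of index two) gives total mass `≥ a·|G|/4` outside `M`.
[folklore] -/
theorem escape_mass_quarter {G : Type*} [Group G] [Fintype G] (M K₁ : Subgroup G) (hM : M ≠ ⊤)
    (hK : K₁.index = 2) (f : G → ℕ) (a : ℕ) (hf : ∀ g : G, g ∉ M → g ∉ K₁ → a ≤ f g) :
    a * Fintype.card G ≤ 4 * ∑ g ∈ Finset.univ.filter (fun g : G => g ∉ M), f g := by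
  have h1 := card_le_four_mul_ncard_compl_union M K₁ hM hK
  rw [Nat.card_eq_fintype_card, ncard_compl_union_eq_card_filter] at h1
  set S := Finset.univ.filter (fun g : G => g ∉ M ∧ g ∉ K₁) with hS
  have hsub : S ⊆ Finset.univ.filter (fun g : G => g ∉ M) := by
    intro g hg
    simp only [hS, Finset.mem_filter, Finset.mem_univ, true_and] at hg ⊢
    exact hg.1
  have h2 : a * S.card ≤ ∑ g ∈ S, f g := by
    calc a * S.card = ∑ _g ∈ S, a := by rw [Finset.sum_const, smul_eq_mul, mul_comm]
      _ ≤ _ := Finset.sum_le_sum fun g hg => by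
          simp only [hS, Finset.mem_filter, Finset.mem_univ, true_and] at hg
          exact hf g hg.1 hg.2
  have h3 : ∑ g ∈ S, f g ≤ ∑ g ∈ Finset.univ.filter (fun g : G => g ∉ M), f g :=
    Finset.sum_le_sum_of_subset hsub
  calc a * Fintype.card G ≤ a * (4 * S.card) := Nat.mul_le_mul_left _ h1
    _ = 4 * (a * S.card) := by ring
    _ ≤ _ := Nat.mul_le_mul_left _ (h2.trans h3)

/-! ## The crux's counted set, fibred over the class group -/

/-- The set counted in `DegreeOnePrimesEscape`: degree-one primes `P` of `𝓞 K` (`N P` a rational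
prime) with `N P ≤ x` whose class lies outside `M` — verbatim the set of the crux. -/
def escapeSet (K : Type) [Field K] [NumberField K] (x : ℕ)
    (M : Subgroup (ClassGroup (𝓞 K))) : Set (Ideal (𝓞 K)) :=
  {P : Ideal (𝓞 K) | P.IsPrime ∧ (Ideal.absNorm P).Prime ∧ Ideal.absNorm P ≤ x ∧
    ∃ hP : P ∈ nonZeroDivisors (Ideal (𝓞 K)), ClassGroup.mk0 ⟨P, hP⟩ ∉ M}

/-- Degree-one primes of norm `≤ x` in a given ideal class `C`. -/
def degOneInClass (K : Type) [Field K] [NumberField K] (x : ℕ) (C : ClassGroup (𝓞 K)) :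
    Set (Ideal (𝓞 K)) :=
  {P : Ideal (𝓞 K) | P.IsPrime ∧ (Ideal.absNorm P).Prime ∧ Ideal.absNorm P ≤ x ∧
    ∃ hP : P ∈ nonZeroDivisors (Ideal (𝓞 K)), ClassGroup.mk0 ⟨P, hP⟩ = C}

/-- The counted set is finite, so `Set.ncard` is the honest cardinality. [folklore] -/
theorem escapeSet_finite (K : Type) [Field K] [NumberField K] (x : ℕ)
    (M : Subgroup (ClassGroup (𝓞 K))) : (escapeSet K x M).Finite := by
  refine (Ideal.finite_setOf_absNorm_le (S := 𝓞 K) x).subset ?_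
  rintro P ⟨-, -, hx, -⟩
  exact hx

/-- Each fibre is finite. [folklore] -/
theorem degOneInClass_finite (K : Type) [Field K] [NumberField K] (x : ℕ)
    (C : ClassGroup (𝓞 K)) : (degOneInClass K x C).Finite := by
  refine (Ideal.finite_setOf_absNorm_le (S := 𝓞 K) x).subset ?_
  rintro P ⟨-, -, hx, -⟩
  exact hx

/-- Distinct classes have disjoint fibres. [folklore] -/
theorem degOneInClass_disjoint (K : Type) [Field K] [NumberField K] (x : ℕ)
    {C C' : ClassGroup (𝓞 K)} (hne : C ≠ C') :
    Disjoint (degOneInClass K x C) (degOneInClass K x C') := by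
  rw [Set.disjoint_left]
  rintro P ⟨-, -, -, hP, rfl⟩ ⟨-, -, -, hP', h'⟩
  exact hne h'

/-- The escape set is the union of the fibres over the classes outside `M`. [folklore] -/
theorem escapeSet_eq_biUnion (K : Type) [Field K] [NumberField K] (x : ℕ)
    (M : Subgroup (ClassGroup (𝓞 K))) :
    escapeSet K x M = ⋃ C ∈ {C : ClassGroup (𝓞 K) | C ∉ M}, degOneInClass K x C := by
  ext P
  simp only [escapeSet, degOneInClass, Set.mem_setOf_eq, Set.mem_iUnion, exists_prop]
  constructor
  · rintro ⟨h1, h2, h3, hP, h4⟩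
    exact ⟨ClassGroup.mk0 ⟨P, hP⟩, h4, h1, h2, h3, hP, rfl⟩
  · rintro ⟨C, hC, h1, h2, h3, hP, rfl⟩
    exact ⟨h1, h2, h3, hP, hC⟩

open scoped Classical in
/-- **Fibre count:** `#escapeSet = Σ_{C ∉ M} #(degree-one primes of norm ≤ x in C)`. [folklore] -/
theorem ncard_escapeSet_eq_sum (K : Type) [Field K] [NumberField K] (x : ℕ)
    (M : Subgroup (ClassGroup (𝓞 K))) :
    (escapeSet K x M).ncard =
      ∑ C ∈ Finset.univ.filter (fun C : ClassGroup (𝓞 K) => C ∉ M),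
        (degOneInClass K x C).ncard := by
  set S := Finset.univ.filter (fun C : ClassGroup (𝓞 K) => C ∉ M) with hS
  set t : ClassGroup (𝓞 K) → Finset (Ideal (𝓞 K)) :=
    fun C => (degOneInClass_finite K x C).toFinset with ht
  have hU : escapeSet K x M = ↑(S.biUnion t) := by
    rw [escapeSet_eq_biUnion, Finset.coe_biUnion]
    apply Set.iUnion_congr
    intro C
    apply Set.iUnion_congr_Prop (by simp [hS])
    intro _
    simp [ht]
  have hdisj : (S : Set (ClassGroup (𝓞 K))).PairwiseDisjoint t := by
    intro C _ C' _ hne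
    rw [Function.onFun, Finset.disjoint_coe.symm]
    simpa [ht] using degOneInClass_disjoint K x hne
  rw [hU, Set.ncard_coe_finset, Finset.card_biUnion hdisj]
  refine Finset.sum_congr rfl fun C _ => ?_
  rw [ht, Set.ncard_eq_toFinset_card _ (degOneInClass_finite K x C)]

/-! ## The combinatorial skeleton of the crux inequality -/

/-- **Skeleton, no exceptional character (or the trivial one):** if every class outside the proper
subgroup `M` holds at least `a` degree-one primes of norm `≤ x` and `π(x) ≤ 4·a·h_K`, then
`π(x) ≤ 8 · #escapeSet` (the inequality of `DegreeOnePrimesEscape`, verbatim). [folklore] -/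
theorem crux_ineq_of_classwise_half (K : Type) [Field K] [NumberField K] (x : ℕ)
    (M : Subgroup (ClassGroup (𝓞 K))) (hM : M ≠ ⊤) (a : ℕ)
    (hf : ∀ C : ClassGroup (𝓞 K), C ∉ M → a ≤ (degOneInClass K x C).ncard)
    (hπ : Nat.primeCounting x ≤ 4 * a * Fintype.card (ClassGroup (𝓞 K))) :
    Nat.primeCounting x ≤ 8 * (escapeSet K x M).ncard := by
  classical
  have h := escape_mass_half M hM (fun C => (degOneInClass K x C).ncard) a hf
  rw [← ncard_escapeSet_eq_sum] at h
  calc Nat.primeCounting x ≤ 4 * a * Fintype.card (ClassGroup (𝓞 K)) := hπ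
    _ = 4 * (a * Fintype.card (ClassGroup (𝓞 K))) := by ring
    _ ≤ 4 * (2 * (escapeSet K x M).ncard) := Nat.mul_le_mul_left _ h
    _ = 8 * (escapeSet K x M).ncard := by ring

/-- **Skeleton, exceptional real character with kernel `K₁` of index two:** if every class outside
`M ∪ K₁` holds at least `a` degree-one primes of norm `≤ x` (nothing is assumed on the depleted
classes in `K₁`) and `π(x) ≤ 2·a·h_K`, then `π(x) ≤ 8 · #escapeSet`. [folklore] -/
theorem crux_ineq_of_classwise_quarter (K : Type) [Field K] [NumberField K] (x : ℕ)
    (M K₁ : Subgroup (ClassGroup (𝓞 K))) (hM : M ≠ ⊤) (hK : K₁.index = 2) (a : ℕ)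
    (hf : ∀ C : ClassGroup (𝓞 K), C ∉ M → C ∉ K₁ → a ≤ (degOneInClass K x C).ncard)
    (hπ : Nat.primeCounting x ≤ 2 * a * Fintype.card (ClassGroup (𝓞 K))) :
    Nat.primeCounting x ≤ 8 * (escapeSet K x M).ncard := by
  classical
  have h := escape_mass_quarter M K₁ hM hK (fun C => (degOneInClass K x C).ncard) a hf
  rw [← ncard_escapeSet_eq_sum] at h
  calc Nat.primeCounting x ≤ 2 * a * Fintype.card (ClassGroup (𝓞 K)) := hπ
    _ = 2 * (a * Fintype.card (ClassGroup (𝓞 K))) := by ring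
    _ ≤ 2 * (4 * (escapeSet K x M).ncard) := Nat.mul_le_mul_left _ h
    _ = 8 * (escapeSet K x M).ncard := by ring

end Summit.QuantumAdvantage.QuantumAdvantage.Theorems.DegreeOnePrimesEscape.Negative
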